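import Summits.BirchSwinnertonDyer.BirchSwinnertonDyer.Theorems.CyclotomicUntwistGNineKernelGeneric
import Summits.BirchSwinnertonDyer.Rank1Residual.Additive.TypeGThreeUnitJ
import Summits.BirchSwinnertonDyer.Rank1Residual.Additive.PotSupersingularClasses
import Summits.BirchSwinnertonDyer.Rank1Residual.Additive.SubGordThree
import Summits.BirchSwinnertonDyer.Rank1Residual.Additive.QuadraticTwistTypeG
import Literature.NumberTheory.EllipticCurves.SelmerCorankControlRatProofs
import HarnessLib

/-!
# Converse of `GNineCriterion`, rational branch: no `3`-adically adapted rational near-root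

Support file for the crux `PSRankOneLowerHalfAtThree` (K1) of the route `CyclotomicUntwist`
(sub-problem `BirchSwinnertonDyer`), part of the converse of `GNineCriterion`
(`TypeGNine W ∧ ClassO6 W 3 ⇒ Δ_min / 3^{v} ≡ 1 (mod 3)`).

Let `W/ℚ` be globally minimal of class O6 at `3` (additive, `ord₃ j ≥ 0`, `f₃ ≠ 2`), with
`v = ord₃ Δ_min` even, and let `F(X) = X³ + AX² + BX + C` be its `2`-cleared cubic
(`A = b₂`, `B = 8b₄`, `C = 16b₆`, `disc F = 2⁸ Δ`).  The orbit argument over `ℚ(ζ₉)`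
(`CyclotomicUntwistGNineConverseOrbit`) leaves, in the non-square case, a RATIONAL number `S`
with `3·ord₃ F′(S) = v`, `6·ord₃ (3S + A) ≥ v` and `2·ord₃ F(S) ≥ v`.  This file shows that no
such `S` exists (`false_of_padic_approx_root`): `3 ∣ v` and `v` even give `6 ∣ v`; for
`v = 12k` the substitution `x = 9ᵏx′ + S`, `y = 27ᵏy′` is integral with unit discriminant, so `W`
has good reduction at `3` — contradicting additivity; for `v = 12k − 6` the same substitution
applied to the quadratic twist by `−3` (`y² = x³ − 3A x² + 9B x − 27C`, discriminant
`3⁶ · disc F`) gives the twist good reduction at `3`, hence `TypeG W 3`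
(`typeG_of_hasGoodReductionAtPrime_quadraticTwist`) and `f₃ = 2`
(`condExpTwo_three_of_typeG_of_addv`) — contradicting `SubW`.

References: J. H. Silverman, *AEC*, VII.1 (change of variables) and VII.5.1(a);
A. Kraus, Manuscripta Math. 69 (1990), Théorème 1 (`p = 3`).
-/

noncomputable section

open scoped Classical NumberField

open WeierstrassCurve IsDedekindDomain IsDedekindDomain.HeightOneSpectrum NumberField WithZero
  Literature.NumberTheory.EllipticCurves Literature.NumberTheory.EllipticCurves.Rank1Residual
  Summit.BirchSwinnertonDyer.Rank1Residual.Additive Rat.HeightOneSpectrum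

set_option linter.dupNamespace false

namespace Summit.BirchSwinnertonDyer.BirchSwinnertonDyer.Theorems.GNineConverse

open Summit.BirchSwinnertonDyer.BirchSwinnertonDyer.Theorems.GNineCriterion

/-! ### The place of `ℚ` at `3` and its valuation in terms of `ord₃` -/

/-- There is a finite place `v` of `𝓞 ℚ` containing `3`, and it is the place of the prime `3`
(`primesEquiv v = 3`). [folklore] -/
theorem exists_place_three :
    ∃ v : HeightOneSpectrum (𝓞 ℚ), (3 : 𝓞 ℚ) ∈ v.asIdeal ∧ (primesEquiv v : ℕ) = 3 := by
  set v : HeightOneSpectrum (𝓞 ℚ) := (primesEquiv (R := 𝓞 ℚ)).symm ⟨3, Nat.prime_three⟩ with hv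
  have hgen : (primesEquiv v : ℕ) = 3 :=
    congrArg Subtype.val ((primesEquiv (R := 𝓞 ℚ)).apply_symm_apply ⟨3, Nat.prime_three⟩)
  refine ⟨v, ?_, hgen⟩
  have h := natCast_natGenerator_mem v
  have hgen' : natGenerator v = 3 := hgen
  rw [hgen'] at h
  exact_mod_cast h

/-- At the place of `3`, `v(x) ≤ v(y) ↔ ord₃ y ≤ ord₃ x` for nonzero rationals (Mathlib's
`valuation_equiv_padicValuation`). [folklore] -/
theorem val_le_iff_padicValRat (v : HeightOneSpectrum (𝓞 ℚ)) (hv : (primesEquiv v : ℕ) = 3)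
    {x y : ℚ} (hx : x ≠ 0) (hy : y ≠ 0) :
    v.valuation ℚ x ≤ v.valuation ℚ y ↔ padicValRat 3 y ≤ padicValRat 3 x := by
  have h := valuation_equiv_padicValuation v x y
  rw [h]
  simp only [Rat.padicValuation, Valuation.coe_mk, MonoidWithZeroHom.coe_mk, ZeroHom.coe_mk, hx,
    hy, if_false, hv, exp_le_exp, neg_le_neg_iff]

/-- `ord₃ 3 = 1`. [folklore] -/
theorem padicValRat_three : padicValRat 3 (3 : ℚ) = 1 := by
  have := padicValRat.self (p := 3) (by norm_num)
  simpa using this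

/-- `ord₃ (3 ^ k) = k`. [folklore] -/
theorem padicValRat_three_pow (k : ℕ) : padicValRat 3 ((3 : ℚ) ^ k) = k := by
  rw [padicValRat.pow (3 : ℚ), padicValRat_three, mul_one]

/-- At the place of `3`: `ord₃ x ≥ k` (or `x = 0`) gives `v(x) ≤ v(3)ᵏ`. [folklore] -/
theorem val_le_val_three_pow (v : HeightOneSpectrum (𝓞 ℚ)) (hv : (primesEquiv v : ℕ) = 3)
    {x : ℚ} (k : ℕ) (h : x = 0 ∨ (k : ℤ) ≤ padicValRat 3 x) :
    v.valuation ℚ x ≤ v.valuation ℚ (3 : ℚ) ^ k := by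
  rcases eq_or_ne x 0 with rfl | hx
  · rw [map_zero]; exact zero_le
  rw [← map_pow, val_le_iff_padicValRat v hv hx (pow_ne_zero _ three_ne_zero),
    padicValRat_three_pow]
  exact h.resolve_left hx

/-- At the place of `3`: `ord₃ x = k` gives `v(x) = v(3)ᵏ`. [folklore] -/
theorem val_eq_val_three_pow (v : HeightOneSpectrum (𝓞 ℚ)) (hv : (primesEquiv v : ℕ) = 3)
    {x : ℚ} (hx : x ≠ 0) (k : ℕ) (h : padicValRat 3 x = k) :
    v.valuation ℚ x = v.valuation ℚ (3 : ℚ) ^ k := by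
  rw [← map_pow]
  apply le_antisymm
  · rw [val_le_iff_padicValRat v hv hx (pow_ne_zero _ three_ne_zero), padicValRat_three_pow, h]
  · rw [val_le_iff_padicValRat v hv (pow_ne_zero _ three_ne_zero) hx, padicValRat_three_pow, h]

/-- At the place of `3`: `ord₃ x ≥ k·n` (or `x = 0`) gives `v(x) ≤ v(3ᵏ)ⁿ`. [folklore] -/
theorem val_le_val_pow_pow (v : HeightOneSpectrum (𝓞 ℚ)) (hv : (primesEquiv v : ℕ) = 3)
    {x : ℚ} (k n : ℕ) (h : x = 0 ∨ ((k * n : ℕ) : ℤ) ≤ padicValRat 3 x) :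
    v.valuation ℚ x ≤ v.valuation ℚ ((3 : ℚ) ^ k) ^ n := by
  rw [map_pow, ← pow_mul]; exact val_le_val_three_pow v hv (k * n) h

/-- At the place of `3`: `ord₃ x = k·n` gives `v(x) = v(3ᵏ)ⁿ`. [folklore] -/
theorem val_eq_val_pow_pow (v : HeightOneSpectrum (𝓞 ℚ)) (hv : (primesEquiv v : ℕ) = 3)
    {x : ℚ} (hx : x ≠ 0) (k n : ℕ) (h : padicValRat 3 x = ((k * n : ℕ) : ℤ)) :
    v.valuation ℚ x = v.valuation ℚ ((3 : ℚ) ^ k) ^ n := by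
  rw [map_pow, ← pow_mul]; exact val_eq_val_three_pow v hv hx (k * n) h

/-! ### `ord₃` bookkeeping -/

/-- `ord₃ (3ᵏ · x) = k + ord₃ x` for `x ≠ 0`. [folklore] -/
theorem padicValRat_three_pow_mul {x : ℚ} (hx : x ≠ 0) (k : ℕ) :
    padicValRat 3 ((3 : ℚ) ^ k * x) = k + padicValRat 3 x := by
  rw [padicValRat.mul (pow_ne_zero _ three_ne_zero) hx, padicValRat_three_pow]

/-- `ord₃ (n · x) = ord₃ x` for an integer `n` prime to `3` and `x ≠ 0`. [folklore] -/
theorem padicValRat_intCast_mul {n : ℤ} (hn : ¬ (3 : ℤ) ∣ n) {x : ℚ} (hx : x ≠ 0) :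
    padicValRat 3 ((n : ℚ) * x) = padicValRat 3 x := by
  have hn0' : n ≠ 0 := fun h ↦ hn (h ▸ dvd_zero 3)
  have hn0 : (n : ℚ) ≠ 0 := by exact_mod_cast hn0'
  rw [padicValRat.mul hn0 hx, padicValRat.of_int,
    padicValInt.eq_zero_of_not_dvd (p := 3) (by exact_mod_cast hn)]
  simp

/-- `ord₃ (2⁸ Δ_min · m) = ord₃ Δ_min` bookkeeping: for the globally minimal `W`,
`ord₃ (n · Δ(W)) = ord₃ Δ_min` for an integer `n` prime to `3`. [folklore] -/
theorem padicValRat_intCast_mul_Δ (W : WeierstrassCurve ℚ) [W.IsElliptic] [W.IsGloballyMinimal]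
    {n : ℤ} (hn : ¬ (3 : ℤ) ∣ n) :
    padicValRat 3 ((n : ℚ) * W.Δ) = padicValInt 3 W.minimalDiscriminantInt := by
  have hΔ0 : W.minimalDiscriminantInt ≠ 0 := minimalDiscriminantInt_ne_zero W
  rw [← cast_minimalDiscriminantInt W, padicValRat_intCast_mul hn (by exact_mod_cast hΔ0),
    padicValRat.of_int]

/-! ### The rational branch is empty -/

/-- **No `3`-adically adapted rational near-root.** For a globally minimal `W/ℚ` of class O6 at `3`
with `v = ord₃ Δ_min` even and `2`-cleared cubic `F = X³ + AX² + BX + C` (`A = b₂`, `B = 8b₄`,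
`C = 16b₆`), there is no rational `S` with `3·ord₃ F′(S) = v`, `6·ord₃(3S + A) ≥ v` (or
`3S + A = 0`) and `2·ord₃ F(S) ≥ v` (or `F(S) = 0`): then `6 ∣ v`; for `v = 12k` the change of
variables `(u, r) = (3ᵏ, S)` shows good reduction of `W` at `3` (contradicting additivity), for
`v = 12k − 6` the change of variables `(u, r) = (3ᵏ, −3S)` on the twist by `−3`
(`y² = x³ − 3A x² + 9B x − 27C`) gives the twist good reduction at `3`, so `TypeG W 3` and
`f₃ = 2` (contradicting `SubW`). [cite: SilvermanAEC2009, VII.1 and VII.5.1(a)] [cite: Kraus1990, Théorème 1] -/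
theorem false_of_padic_approx_root (W : WeierstrassCurve ℚ) [W.IsElliptic] [W.IsGloballyMinimal]
    (hO6 : ClassO6 W 3) (hev : Even (padicValInt 3 W.minimalDiscriminantInt))
    (A B C S : ℚ) (hA : A = W.b₂) (hB : B = 8 * W.b₄) (hC : C = 16 * W.b₆)
    (hb : 3 * padicValRat 3 (3 * S ^ 2 + 2 * A * S + B) = padicValInt 3 W.minimalDiscriminantInt)
    (ha : 3 * S + A = 0 ∨
      (padicValInt 3 W.minimalDiscriminantInt : ℤ) ≤ 6 * padicValRat 3 (3 * S + A))
    (hc : S ^ 3 + A * S ^ 2 + B * S + C = 0 ∨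
      (padicValInt 3 W.minimalDiscriminantInt : ℤ) ≤
        2 * padicValRat 3 (S ^ 3 + A * S ^ 2 + B * S + C)) :
    False := by
  obtain ⟨-, hadd, -, hf2⟩ := hO6
  set v : ℕ := padicValInt 3 W.minimalDiscriminantInt with hvdef
  -- `1 ≤ v` (bad reduction at `3`)
  have hΔ0 : W.minimalDiscriminantInt ≠ 0 := minimalDiscriminantInt_ne_zero W
  have hv1 : 1 ≤ v := by
    have h3Δ : (3 : ℤ) ∣ (integralModelInt W).Δ := three_dvd_Δ_of_not_good W hadd.1
    have := (three_pow_dvd_iff 1 (integralModelInt W).Δ).mp (by simpa using h3Δ)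
    exact this.resolve_left hΔ0
  -- `6 ∣ v`
  have hb0 : 3 * S ^ 2 + 2 * A * S + B ≠ 0 := by
    intro h0
    rw [h0, padicValRat.zero, mul_zero] at hb
    have : (v : ℤ) = 0 := by exact_mod_cast hb.symm
    omega
  have h6 : 6 ∣ v := by
    obtain ⟨r, hr⟩ := hev
    have h3 : (3 : ℤ) ∣ (v : ℤ) := ⟨_, hb.symm⟩
    omega
  obtain ⟨m, hm⟩ := h6
  -- the place of `3` and the discriminant of `F`
  obtain ⟨v₃, hv₃, hpe⟩ := exists_place_three
  have hdisc : A ^ 2 * B ^ 2 - 4 * B ^ 3 - 4 * A ^ 3 * C - 27 * C ^ 2 + 18 * A * B * C =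
      256 * W.Δ := by
    rw [hA, hB, hC]; exact disc_b_eq W
  have hΔne : ((4096 : ℤ) : ℚ) * W.Δ ≠ 0 :=
    mul_ne_zero (by norm_num) (by rw [← cast_minimalDiscriminantInt W]; exact_mod_cast hΔ0)
  have hΔv : padicValRat 3 (((4096 : ℤ) : ℚ) * W.Δ) = v :=
    padicValRat_intCast_mul_Δ W (by norm_num)
  have ha' : 3 * S + A ≠ 0 → (v : ℤ) ≤ 6 * padicValRat 3 (3 * S + A) := fun hne ↦
    ha.resolve_left hne
  have hc' : S ^ 3 + A * S ^ 2 + B * S + C ≠ 0 →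
      (v : ℤ) ≤ 2 * padicValRat 3 (S ^ 3 + A * S ^ 2 + B * S + C) := fun hne ↦
    hc.resolve_left hne
  rcases Nat.even_or_odd m with ⟨k, hk⟩ | ⟨k, hk⟩
  · -- `v = 12k`: `W` itself has good reduction at `3`
    have hvk : (v : ℤ) = 12 * k := by rw [hm, hk]; push_cast; ring
    have hu : ((3 : ℚ) ^ k) ≠ 0 := pow_ne_zero _ three_ne_zero
    have hVgood : (⟨0, A, 0, B, C⟩ : WeierstrassCurve ℚ).HasGoodReductionAt v₃ := by
      refine hasGoodReductionAt_of_translate_scale v₃ A B C S ((3 : ℚ) ^ k) hu ?_ ?_ ?_ ?_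
      · have he : (A + 3 * S : ℚ) = 3 * S + A := by ring
        rw [he]
        refine val_le_val_pow_pow v₃ hpe k 2 ?_
        rcases eq_or_ne (3 * S + A) 0 with ha0 | hne
        · exact Or.inl ha0
        · right; have := ha' hne; push_cast; linarith
      · have he : (B + 2 * S * A + 3 * S ^ 2 : ℚ) = 3 * S ^ 2 + 2 * A * S + B := by ring
        rw [he]
        refine val_le_val_pow_pow v₃ hpe k 4 (Or.inr ?_)
        push_cast; linarith
      · have he : (C + S * B + S ^ 2 * A + S ^ 3 : ℚ) = S ^ 3 + A * S ^ 2 + B * S + C := by ring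
        rw [he]
        refine val_le_val_pow_pow v₃ hpe k 6 ?_
        rcases eq_or_ne (S ^ 3 + A * S ^ 2 + B * S + C) 0 with hc0 | hne
        · exact Or.inl hc0
        · right; have := hc' hne; push_cast; linarith
      · have he : (16 * (A ^ 2 * B ^ 2 - 4 * B ^ 3 - 4 * A ^ 3 * C - 27 * C ^ 2 +
            18 * A * B * C) : ℚ) = ((4096 : ℤ) : ℚ) * W.Δ := by
          rw [hdisc]; push_cast; ring
        rw [he]
        refine val_eq_val_pow_pow v₃ hpe hΔne k 12 ?_
        rw [hΔv, hvk]; push_cast; ring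
    have hWgood : W.HasGoodReductionAt v₃ := by
      rw [hasGoodReductionAt_iff_cubicModel v₃ W, ← hA, ← hB, ← hC]
      exact hVgood
    exact hadd.1 (hasGoodReductionAtPrime_of_hasGoodReductionAt W v₃ hv₃ hWgood)
  · -- `v = 12k + 6`: the twist by `-3` has good reduction at `3`
    have hvk : (v : ℤ) = 12 * k + 6 := by rw [hm, hk]; push_cast; ring
    have hu : ((3 : ℚ) ^ (k + 1)) ≠ 0 := pow_ne_zero _ three_ne_zero
    set M : WeierstrassCurve ℚ := ⟨0, -3 * A, 0, 9 * B, -27 * C⟩ with hM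
    have hMgood : M.HasGoodReductionAt v₃ := by
      refine hasGoodReductionAt_of_translate_scale v₃ (-3 * A) (9 * B) (-27 * C) (-3 * S)
        ((3 : ℚ) ^ (k + 1)) hu ?_ ?_ ?_ ?_
      · have he : (-3 * A + 3 * (-3 * S) : ℚ) = (3 : ℚ) ^ 1 * (-(3 * S + A)) := by ring
        rw [he]
        refine val_le_val_pow_pow v₃ hpe (k + 1) 2 ?_
        rcases eq_or_ne (3 * S + A) 0 with ha0 | hne
        · left; rw [ha0]; ring
        · right
          rw [padicValRat_three_pow_mul (neg_ne_zero.mpr hne), padicValRat.neg]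
          have := ha' hne
          push_cast; linarith
      · have he : (9 * B + 2 * (-3 * S) * (-3 * A) + 3 * (-3 * S) ^ 2 : ℚ) =
            (3 : ℚ) ^ 2 * (3 * S ^ 2 + 2 * A * S + B) := by ring
        rw [he]
        refine val_le_val_pow_pow v₃ hpe (k + 1) 4 (Or.inr ?_)
        rw [padicValRat_three_pow_mul hb0]
        push_cast; linarith
      · have he : (-27 * C + -3 * S * (9 * B) + (-3 * S) ^ 2 * (-3 * A) + (-3 * S) ^ 3 : ℚ) =
            (3 : ℚ) ^ 3 * (-(S ^ 3 + A * S ^ 2 + B * S + C)) := by ring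
        rw [he]
        refine val_le_val_pow_pow v₃ hpe (k + 1) 6 ?_
        rcases eq_or_ne (S ^ 3 + A * S ^ 2 + B * S + C) 0 with hc0 | hne
        · left; rw [hc0]; ring
        · right
          rw [padicValRat_three_pow_mul (neg_ne_zero.mpr hne), padicValRat.neg]
          have := hc' hne
          push_cast; linarith
      · have he : (16 * ((-3 * A) ^ 2 * (9 * B) ^ 2 - 4 * (9 * B) ^ 3 -
            4 * (-3 * A) ^ 3 * (-27 * C) - 27 * (-27 * C) ^ 2 +
            18 * (-3 * A) * (9 * B) * (-27 * C)) : ℚ) =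
            (3 : ℚ) ^ 6 * (((4096 : ℤ) : ℚ) * W.Δ) := by
          rw [show ((4096 : ℤ) : ℚ) * W.Δ = 16 * (256 * W.Δ) by push_cast; ring, ← hdisc]; ring
        rw [he]
        refine val_eq_val_pow_pow v₃ hpe (mul_ne_zero (pow_ne_zero _ three_ne_zero) hΔne)
          (k + 1) 12 ?_
        rw [padicValRat_three_pow_mul hΔne, hΔv, hvk]; push_cast; ring
    -- `W^{(-3)} = ⟨2, 0, 0, 0⟩ • M`
    have htw : W.quadraticTwist ((-1 : ℚ) ^ (3 / 2) * (3 : ℕ)) =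
        (⟨Units.mk0 (2 : ℚ) two_ne_zero, 0, 0, 0⟩ : VariableChange ℚ) • M := by
      have h32 : ((-1 : ℚ) ^ (3 / 2) * (3 : ℕ) : ℚ) = -3 := by norm_num
      rw [h32, quadraticTwist]
      ext
      · simp [variableChange_a₁, hM]
      · rw [variableChange_a₂]; simp [hM, hA]; ring
      · simp [variableChange_a₃, hM]
      · rw [variableChange_a₄]; simp [hM, hB]; ring
      · rw [variableChange_a₆]; simp [hM, hC]; ring
    have htwgood : (W.quadraticTwist ((-1 : ℚ) ^ (3 / 2) * (3 : ℕ))).HasGoodReductionAt v₃ := by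
      rw [htw]; exact (hasGoodReductionAt_smul_iff_holds v₃ M _).mpr hMgood
    have hG : TypeG W 3 :=
      typeG_of_hasGoodReductionAtPrime_quadraticTwist W 3 (by norm_num)
        (hasGoodReductionAtPrime_of_hasGoodReductionAt _ v₃ hv₃ htwgood)
    exact hf2 (condExpTwo_three_of_typeG_of_addv W hG hadd)

end Summit.BirchSwinnertonDyer.BirchSwinnertonDyer.Theorems.GNineConverse

end
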